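import Literature.NumberTheory.QuadraticFields.GenusCharacterFactorization
import Literature.NumberTheory.QuadraticFields.AmbiguousClasses
import Literature.NumberTheory.QuadraticFields.KroneckerSplitting
import Literature.NumberTheory.NumberFields.RealCharactersCard
import Literature.NumberTheory.LFunctions.DegreeOnePrimes
import Mathlib.NumberTheory.LSeries.PrimesInAP
import HarnessLib

/-!
# Genus theory of imaginary quadratic fields, IV: the genus characters exhaust the real
# characters of the class group, and Siegel's bound for all real class group characters

Topic `NumberTheory/QuadraticFields`, namespace `Literature.NumberTheory.QuadraticFields.Quadratic`
(continuing `GenusCharacterFactorization.lean`).  Everything here is PROVED (theorems only).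

Let `K` be an imaginary quadratic field, `d = d_K`, `t = ω(|d|)`, and let `P₀` be the set of odd
prime divisors of `d` with, for odd `d`, one of them removed (`|P₀| = t − 1` in both cases).

* `exists_prime_absNorm_eq` — a rational prime `q ∤ 2d` with `(d/q) = 1` is the norm of a prime of
  `K` (Dedekind–Kummer: `X² − tX − m` has two roots mod `q`; the tree's `DegreeOnePrimes`);
* `exists_unit_eq_one_and_eq_neg_one` — for a primitive quadratic `κ mod D` and a quadratic
  `χ₀ ≠ 1 mod D₁`, `D₁ ∣ D`, `D₁ < D`: a unit `x mod D` with `κ(x) = 1`, `χ₀(x) = −1`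
  (`κ` does not factor through `D₁`);
* `exists_prime_jacobiSym_genusModulus_eq_neg_one` — for `∅ ≠ U` with `D_U < |d|`: a prime `𝔮`
  of prime norm `q > |d|` with `(q / D_U) = −1` (Dirichlet's theorem on primes in progressions),
  so that `ψ_U(𝔮) = −1` and **`ψ_U ≠ 1`**;
* `genusCharProd_injective` — `S ↦ ψ_S` is injective on the subsets of `P₀`;
* `exists_genusCharProd_eq` — **every real character `χ` of `Cl_K` (`χ² = 1`) is a genus character
  `ψ_S`, `S ⊆ P₀`**: the `2^{t−1}` characters `ψ_S` are distinct real characters, and the real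
  characters number `|Cl_K[2]| = 2^{t−1}` (`card_monoidHom_mul_self_eq_one`,
  `card_sq_eq_one_classGroup`) — Gauss's theorem that the number of genera is `2^{t−1}`;
* `exists_one_sub_realZero_classGroupLFunction₀_ge` — **Siegel's bound for real class group
  characters**: for every `ε > 0` there is `C(ε) > 0` with `C |d_K|^{−ε} ≤ 1 − β` for every
  imaginary quadratic `K`, every real `χ ≠ 1` and every real `β` with `L₀(β, χ) = 0`
  (Thorner–Zaman 2019, Thm. 3.3 in the imaginary quadratic, unramified case).

## References

* [Cox2013] D. A. Cox, *Primes of the form x² + ny²*, 2nd ed. (2013), §3.B Thm. 3.15.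
* [ThornerZaman2019] J. Thorner, A. Zaman, *A unified and improved Chebotarev density theorem*,
  Algebra & Number Theory 13 (2019), Thm. 3.3.
-/

noncomputable section

open scoped nonZeroDivisors NumberField NumberTheorySymbols
open Module NumberField Ideal IsDedekindDomain Polynomial Finset
open Literature.NumberTheory.EllipticCurves
open Literature.NumberTheory.LFunctions.NumberField

namespace Literature.NumberTheory.QuadraticFields.Quadratic

variable {K : Type*} [Field K] [NumberField K]

/-! ### Split primes are norms of primes -/

/-- **A prime `q ∤ 2 d_K` with `(d_K / q) = 1` is the norm of a prime ideal of `K`**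
(`[K : ℚ] = 2`): `X² − tX − m ≡ (X − a)(X − c)`, `a ≠ c (mod q)`, so there are two ideals of norm
`q` (Dedekind–Kummer, `DegreeOnePrimes.card_absNorm_eq_prime_eq_card_roots`).
[cite: Cox2013, §5.B Prop. 5.16] -/
theorem exists_prime_absNorm_eq (h2 : finrank ℚ K = 2) {q : ℕ} (hq : q.Prime) (hq2 : q ≠ 2)
    (hqd : ¬ (q : ℤ) ∣ NumberField.discr K) (hJ : J(NumberField.discr K | q) = 1) :
    ∃ v : HeightOneSpectrum (𝓞 K), Ideal.absNorm v.asIdeal = q := by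
  classical
  haveI := Fact.mk hq
  obtain ⟨b, hb⟩ := exists_basis_zero_eq_one (K := K) h2
  set m : ℤ := b.repr (b 1 * b 1) 0 with hm
  set t : ℤ := b.repr (b 1 * b 1) 1 with ht
  have hDK : NumberField.discr K = t ^ 2 + 4 * m := discr_eq_sq_add_four_mul b hb
  have hd0 : ((NumberField.discr K : ℤ) : ZMod q) ≠ 0 := by
    rwa [Ne, ZMod.intCast_zmod_eq_zero_iff_dvd]
  have hsq : IsSquare ((NumberField.discr K : ℤ) : ZMod q) :=
    (legendreSym.eq_one_iff q hd0).mp (by rw [jacobiSym.legendreSym.to_jacobiSym]; exact hJ)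
  obtain ⟨s, hs⟩ := hsq
  have hs' : s ^ 2 = (t : ZMod q) ^ 2 + 4 * (m : ZMod q) := by
    rw [sq, ← hs, hDK]; push_cast; ring
  haveI : NeZero (2 : ZMod q) := ⟨two_ne_zero_zmod hq2⟩
  have h20 : (2 : ZMod q) ≠ 0 := NeZero.ne 2
  have hs0 : s ≠ 0 := by
    rintro rfl
    rw [mul_zero] at hs
    exact hd0 hs
  have hac : ((t + s) / 2 : ZMod q) ≠ (t - s) / 2 := by
    intro h
    have : (t : ZMod q) + s = t - s := by
      have := congrArg (· * (2 : ZMod q)) h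
      simpa [div_mul_cancel₀ _ h20] using this
    have h2s : (2 : ZMod q) * s = 0 := by linear_combination this
    rcases mul_eq_zero.mp h2s with h | h
    · exact h20 h
    · exact hs0 h
  have hfac : (minpoly ℤ (b 1)).map (Int.castRingHom (ZMod q)) =
      (X - Polynomial.C ((t + s) / 2 : ZMod q)) * (X - Polynomial.C ((t - s) / 2 : ZMod q)) := by
    rw [minpoly_basis_one b hb, ← X_sq_sub_eq_mul_of_sq_eq hs']
    simp only [Polynomial.map_sub, Polynomial.map_pow, Polynomial.map_mul, Polynomial.map_X,
      Polynomial.map_intCast, eq_intCast, Polynomial.C_eq_intCast]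
    rfl
  have hcard : ((minpoly ℤ (b 1)).map (Int.castRingHom (ZMod q))).roots.toFinset.card = 2 := by
    rw [hfac, Polynomial.roots_mul (mul_ne_zero (X_sub_C_ne_zero _) (X_sub_C_ne_zero _)),
      roots_X_sub_C, roots_X_sub_C, Multiset.toFinset_add, Multiset.toFinset_singleton,
      Multiset.toFinset_singleton, Finset.card_union_of_disjoint (by simpa using hac)]
    rfl
  have hexp : ¬ q ∣ RingOfIntegers.exponent (b 1) := by
    rw [exponent_basis_one b hb]; exact hq.not_dvd_one
  have hN := Literature.NumberTheory.LFunctions.DegreeOnePrimes.card_absNorm_eq_prime_eq_card_roots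
    (K := K) (α := b 1) (p := q) hexp
  rw [hcard] at hN
  have hne : Nonempty {I : Ideal (𝓞 K) // Ideal.absNorm I = q} := by
    by_contra h
    rw [not_nonempty_iff] at h
    rw [Nat.card_of_isEmpty] at hN
    exact absurd hN (by norm_num)
  obtain ⟨⟨I, hI⟩⟩ := hne
  have hprime : I.IsPrime := Ideal.isPrime_of_irreducible_absNorm
    (hI ▸ (Nat.irreducible_iff_nat_prime q).mpr hq)
  have hI0 : I ≠ ⊥ := fun h ↦ hq.ne_zero (by rw [← hI]; exact Ideal.absNorm_eq_zero_iff.mpr h)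
  exact ⟨⟨I, hprime, hI0⟩, hI⟩

/-! ### A unit with prescribed values of two quadratic characters -/

/-- A quadratic character takes the values `±1` on units. [folklore] -/
theorem apply_unit_eq_one_or {D : ℕ} {χ : DirichletCharacter ℂ D} (hχ : χ ^ 2 = 1) (x : (ZMod D)ˣ) :
    χ x = 1 ∨ χ x = -1 := by
  have h : χ x ^ 2 = 1 := by rw [← MulChar.pow_apply_coe, hχ, MulChar.one_apply_coe]
  rw [sq] at h
  exact mul_self_eq_one_iff.mp h

/-- **A unit `x mod D` with `κ(x) = 1` and `χ₀(x) = −1`**, for `κ` a primitive quadratic character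
mod `D` and `χ₀ ≠ 1` a quadratic character mod `D₁ ∣ D`, `D₁ < D`: a unit `x₁` with `χ₀(x₁) = −1`
exists, and if `κ(x₁) = −1` one multiplies by a unit `x₂ ≡ 1 (mod D₁)` with `κ(x₂) = −1`, which
exists because `κ` does not factor through `D₁` (Mathlib `factorsThrough_iff_ker_unitsMap`). [folklore] -/
theorem exists_unit_eq_one_and_eq_neg_one {D : ℕ} [NeZero D] {κ : DirichletCharacter ℂ D}
    (hκ2 : κ ^ 2 = 1) (hprim : κ.IsPrimitive) {D₁ : ℕ} [NeZero D₁] (hd : D₁ ∣ D) (hlt : D₁ < D)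
    {χ₀ : DirichletCharacter ℂ D₁} (hχ₀2 : χ₀ ^ 2 = 1) (hχ₀ : χ₀ ≠ 1) :
    ∃ x : (ZMod D)ˣ, κ x = 1 ∧ DirichletCharacter.changeLevel hd χ₀ x = -1 := by
  set χ₁ := DirichletCharacter.changeLevel hd χ₀ with hχ₁def
  have hχ₁ : χ₁ ≠ 1 := by
    intro h
    apply hχ₀
    apply DirichletCharacter.changeLevel_injective hd
    rw [← hχ₁def, h, map_one]
  have hχ₁2 : χ₁ ^ 2 = 1 := by rw [hχ₁def, ← map_pow, hχ₀2, map_one]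
  obtain ⟨x₁, hx₁⟩ := MulChar.ne_one_iff.mp hχ₁
  have hx₁' : χ₁ x₁ = -1 := (apply_unit_eq_one_or hχ₁2 x₁).resolve_left hx₁
  by_cases hκx : κ x₁ = 1
  · exact ⟨x₁, hκx, hx₁'⟩
  have hκx' : κ x₁ = -1 := (apply_unit_eq_one_or hκ2 x₁).resolve_left hκx
  -- `κ` does not factor through `D₁`
  have hnft : ¬ κ.FactorsThrough D₁ := by
    intro hft
    have h1 := DirichletCharacter.conductor_dvd_of_mem_conductorSet κ
      ((DirichletCharacter.mem_conductorSet_iff κ).mpr hft)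
    rw [(DirichletCharacter.isPrimitive_def κ).mp hprim] at h1
    exact absurd (Nat.le_of_dvd (Nat.pos_of_ne_zero (NeZero.ne D₁)) h1) (not_le.mpr hlt)
  rw [DirichletCharacter.factorsThrough_iff_ker_unitsMap hd, SetLike.not_le_iff_exists] at hnft
  obtain ⟨x₂, hx₂ker, hx₂⟩ := hnft
  have hκ₂ : κ x₂ = -1 := by
    refine (apply_unit_eq_one_or hκ2 x₂).resolve_left fun h ↦ hx₂ ?_
    rw [MonoidHom.mem_ker]
    exact Units.val_eq_one.mp (by rw [MulChar.coe_toUnitHom]; exact h)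
  have hχ₂ : χ₁ x₂ = 1 := by
    rw [← MulChar.coe_toUnitHom, hχ₁def, DirichletCharacter.changeLevel_toUnitHom, MonoidHom.comp_apply,
      (MonoidHom.mem_ker).mp hx₂ker, map_one, Units.val_one]
  refine ⟨x₁ * x₂, ?_, ?_⟩
  · rw [Units.val_mul, map_mul, hκx', hκ₂]; norm_num
  · rw [Units.val_mul, map_mul, hx₁', hχ₂]; norm_num

/-! ### A prime with `ψ_U(𝔮) = −1` -/

/-- **For `∅ ≠ U` with `D_U < |d_K|` there is a prime `𝔮` of `K` of prime norm `q > |d_K|` with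
`(q / D_U) = −1`**: a unit `x mod |d|` with `κ(x) = 1`, `(x/D_U) = −1`; a prime `q ≡ x (mod |d|)`,
`q > 2|d|` (Dirichlet); then `(d/q) = κ(q) = 1`, so `q` is the norm of a prime (`exists_prime_absNorm_eq`),
and `(q/D_U) = (x/D_U) = −1`. [cite: Cox2013, §3.B Thm. 3.15] -/
theorem exists_prime_jacobiSym_genusModulus_eq_neg_one (h2 : finrank ℚ K = 2) {U : Finset ℕ}
    (hU : ∀ p ∈ U, p.Prime ∧ p ≠ 2 ∧ (p : ℤ) ∣ NumberField.discr K) (hne : U.Nonempty)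
    (hlt : genusModulus U < (NumberField.discr K).natAbs) :
    ∃ (v : HeightOneSpectrum (𝓞 K)) (q : ℕ), q.Prime ∧ Ideal.absNorm v.asIdeal = q ∧
      (NumberField.discr K).natAbs < q ∧ J(q | genusModulus U) = -1 := by
  set D : ℕ := (NumberField.discr K).natAbs with hDdef
  haveI : NeZero D := ⟨Int.natAbs_ne_zero.mpr (NumberField.discr_ne_zero K)⟩
  haveI : NeZero (genusModulus U) := ⟨genusModulus_ne_zero fun p hp ↦ (hU p hp).1.ne_zero⟩
  obtain ⟨M, _, κ, hMd, -, hκ2, hprim, hoddp, -⟩ := exists_kroneckerChar_values (K := K) h2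
  subst hMd
  have hd : genusModulus U ∣ D := genusModulus_dvd_natAbs_discr hU
  have hχ₀ : jacobiChar (genusModulus U) ≠ 1 :=
    jacobiChar_genusModulus_ne_one (fun p hp ↦ ⟨(hU p hp).1, (hU p hp).2.1⟩) hne
  have hχ₀2 : jacobiChar (genusModulus U) ^ 2 = 1 :=
    MulChar.IsQuadratic.sq_eq_one (fun a ↦ jacobiChar_trichotomy a)
  obtain ⟨x, hκx, hχx⟩ := exists_unit_eq_one_and_eq_neg_one hκ2 hprim hd hlt hχ₀2 hχ₀
  -- Dirichlet: a prime `q ≡ x (mod D)`, `q > 2D`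
  obtain ⟨q, hqgt, hq, hqx⟩ := Nat.forall_exists_prime_gt_and_eq_mod (Units.isUnit x) (2 * D)
  have hDpos : 0 < D := Nat.pos_of_ne_zero (NeZero.ne D)
  have hq2 : q ≠ 2 := by omega
  have hqD : D < q := by omega
  have hqd : ¬ (q : ℤ) ∣ NumberField.discr K := by
    intro h
    have : q ∣ D := Int.natCast_dvd.mp h
    exact absurd (Nat.le_of_dvd hDpos this) (by omega)
  -- `κ(q) = 1`, i.e. `(d/q) = 1`: `q` splits
  have hJ : J(NumberField.discr K | q) = 1 := by
    have := hoddp q hq hq2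
    rw [hqx, hκx] at this
    exact_mod_cast this.symm
  obtain ⟨v, hv⟩ := exists_prime_absNorm_eq h2 hq hq2 hqd hJ
  refine ⟨v, q, hq, hv, hqD, ?_⟩
  -- `(q / D_U) = χ₁(x) = −1`
  have h1 : DirichletCharacter.changeLevel hd (jacobiChar (genusModulus U)) (q : ZMod D) =
      (J(q | genusModulus U) : ℂ) := by
    rw [hqx, DirichletCharacter.changeLevel_eq_cast_of_dvd, ← hqx, ZMod.cast_natCast hd,
      jacobiChar_natCast]
  rw [hqx, hχx] at h1
  exact_mod_cast h1.symm

/-- Off the primes over `D`, the norm `q > |d| ≥ D_S` is prime to every `D_S`, `S` a set of odd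
ramified primes. [folklore] -/
theorem coprime_genusModulus_of_lt {S : Finset ℕ}
    (hS : ∀ p ∈ S, p.Prime ∧ p ≠ 2 ∧ (p : ℤ) ∣ NumberField.discr K) {q : ℕ} (hq : q.Prime)
    (hqD : (NumberField.discr K).natAbs < q) : q.Coprime (genusModulus S) := by
  refine hq.coprime_iff_not_dvd.mpr fun h ↦ ?_
  have hD0 : 0 < (NumberField.discr K).natAbs := Int.natAbs_pos.mpr (NumberField.discr_ne_zero K)
  have h1 : genusModulus S ≤ (NumberField.discr K).natAbs :=
    Nat.le_of_dvd hD0 (genusModulus_dvd_natAbs_discr hS)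
  have h2 : q ≤ genusModulus S :=
    Nat.le_of_dvd (Nat.pos_of_ne_zero (genusModulus_ne_zero fun p hp ↦ (hS p hp).1.ne_zero)) h
  omega

/-- **`ψ_U ≠ 1` for `∅ ≠ U` with `D_U < |d_K|`.** [cite: Cox2013, §3.B Thm. 3.15] -/
theorem genusCharProd_ne_one (hK : IsImaginaryQuadratic K) {U : Finset ℕ}
    (hU : ∀ p ∈ U, p.Prime ∧ p ≠ 2 ∧ (p : ℤ) ∣ NumberField.discr K) (hne : U.Nonempty)
    (hlt : genusModulus U < (NumberField.discr K).natAbs) : genusCharProd hK U hU ≠ 1 := by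
  haveI : NeZero (genusModulus U) := ⟨genusModulus_ne_zero fun p hp ↦ (hU p hp).1.ne_zero⟩
  obtain ⟨v, q, hq, hv, hqD, hJ⟩ := exists_prime_jacobiSym_genusModulus_eq_neg_one hK.1 hU hne hlt
  intro h1
  have hcop : (Ideal.absNorm v.asIdeal).Coprime (genusModulus U) := by
    rw [hv]; exact coprime_genusModulus_of_lt hU hq hqD
  have hval := genusCharProd_agree (hK := hK) (hS := hU) v hcop
  rw [h1, classGroupCharPrimeValue_apply, MonoidHom.one_apply, Units.val_one, hv, jacobiChar_natCast,
    hJ] at hval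
  norm_num at hval

/-! ### Injectivity of `S ↦ ψ_S` -/

/-- `D_S D_T = D_{S ∆ T} · D_{S ∩ T}²`. [folklore] -/
theorem genusModulus_mul_genusModulus (S T : Finset ℕ) :
    genusModulus S * genusModulus T = genusModulus (symmDiff S T) * genusModulus (S ∩ T) ^ 2 := by
  classical
  simp only [genusModulus]
  have hS : (∏ p ∈ S \ T, p) * ∏ p ∈ S ∩ T, p = ∏ p ∈ S, p := by
    rw [← Finset.sdiff_inter_self_left S T]
    exact Finset.prod_sdiff Finset.inter_subset_left
  have hT : (∏ p ∈ T \ S, p) * ∏ p ∈ S ∩ T, p = ∏ p ∈ T, p := by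
    rw [Finset.inter_comm, ← Finset.sdiff_inter_self_left T S]
    exact Finset.prod_sdiff Finset.inter_subset_left
  have hU : ∏ p ∈ symmDiff S T, p = (∏ p ∈ S \ T, p) * ∏ p ∈ T \ S, p := by
    rw [show symmDiff S T = S \ T ∪ T \ S from symmDiff_def S T,
      Finset.prod_union disjoint_sdiff_sdiff]
  rw [← hS, ← hT, hU]
  ring

/-- The odd ramified primes of the symmetric difference. [folklore] -/
theorem forall_mem_symmDiff {S T : Finset ℕ} {P : ℕ → Prop} (hS : ∀ p ∈ S, P p) (hT : ∀ p ∈ T, P p) :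
    ∀ p ∈ symmDiff S T, P p := by
  intro p hp
  rcases Finset.mem_symmDiff.mp hp with ⟨h, -⟩ | ⟨h, -⟩
  · exact hS p h
  · exact hT p h

/-- **`ψ_S = ψ_T ⟹ S = T`** when `D_{S∆T} < |d_K|`: otherwise a prime `𝔮` of norm `q` with
`(q/D_{S∆T}) = −1` has `ψ_S(𝔮) ψ_T(𝔮) = (q/D_S)(q/D_T) = (q/D_{S∆T}) (q/D_{S∩T})² = −1`, while
`ψ_S(𝔮) = ψ_T(𝔮) = ±1`. [cite: Cox2013, §3.B Thm. 3.15] -/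
theorem eq_of_genusCharProd_eq (hK : IsImaginaryQuadratic K) {S T : Finset ℕ}
    (hS : ∀ p ∈ S, p.Prime ∧ p ≠ 2 ∧ (p : ℤ) ∣ NumberField.discr K)
    (hT : ∀ p ∈ T, p.Prime ∧ p ≠ 2 ∧ (p : ℤ) ∣ NumberField.discr K)
    (heq : genusCharProd hK S hS = genusCharProd hK T hT)
    (hlt : genusModulus (symmDiff S T) < (NumberField.discr K).natAbs) : S = T := by
  by_contra hne
  have hU : ∀ p ∈ symmDiff S T, p.Prime ∧ p ≠ 2 ∧ (p : ℤ) ∣ NumberField.discr K :=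
    forall_mem_symmDiff hS hT
  have hUne : (symmDiff S T).Nonempty := by
    rw [Finset.nonempty_iff_ne_empty, Ne, ← Finset.bot_eq_empty, symmDiff_eq_bot]
    exact hne
  haveI : NeZero (genusModulus S) := ⟨genusModulus_ne_zero fun p hp ↦ (hS p hp).1.ne_zero⟩
  haveI : NeZero (genusModulus T) := ⟨genusModulus_ne_zero fun p hp ↦ (hT p hp).1.ne_zero⟩
  have hI0 : genusModulus (S ∩ T) ≠ 0 :=
    genusModulus_ne_zero fun p hp ↦ (hS p (Finset.mem_inter.mp hp).1).1.ne_zero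
  have hU0 : genusModulus (symmDiff S T) ≠ 0 := genusModulus_ne_zero fun p hp ↦ (hU p hp).1.ne_zero
  obtain ⟨v, q, hq, hv, hqD, hJ⟩ := exists_prime_jacobiSym_genusModulus_eq_neg_one hK.1 hU hUne hlt
  -- the two values at `v`
  have hvS := genusCharProd_agree (hK := hK) (hS := hS) v (by rw [hv]; exact coprime_genusModulus_of_lt hS hq hqD)
  have hvT := genusCharProd_agree (hK := hK) (hS := hT) v (by rw [hv]; exact coprime_genusModulus_of_lt hT hq hqD)
  rw [heq, hvT, hv, jacobiChar_natCast, jacobiChar_natCast, Int.cast_inj] at hvS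
  -- `(q/D_S)(q/D_T) = (q/D_U)(q/D_∩)² = −1`
  have hmul : J(q | genusModulus S) * J(q | genusModulus T) =
      J(q | genusModulus (symmDiff S T)) * J(q | genusModulus (S ∩ T)) ^ 2 := by
    rw [← jacobiSym.mul_right' _ (NeZero.ne _) (NeZero.ne _), genusModulus_mul_genusModulus, sq,
      jacobiSym.mul_right' _ hU0 (mul_ne_zero hI0 hI0), jacobiSym.mul_right' _ hI0 hI0, sq]
  have hsq : J(q | genusModulus (S ∩ T)) ^ 2 = 1 := by
    haveI : NeZero (genusModulus (S ∩ T)) := ⟨hI0⟩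
    have hcop : (q : ℤ).gcd (genusModulus (S ∩ T)) = 1 := by
      rw [Int.gcd_natCast_natCast]
      exact coprime_genusModulus_of_lt (fun p hp ↦ hS p (Finset.mem_inter.mp hp).1) hq hqD
    have hne0 : J(q | genusModulus (S ∩ T)) ≠ 0 := by
      rw [Ne, jacobiSym.eq_zero_iff_not_coprime]; exact fun h ↦ h hcop
    rcases jacobiSym.trichotomy (q : ℤ) (genusModulus (S ∩ T)) with h | h | h
    · exact absurd h hne0
    · rw [h]; norm_num
    · rw [h]; norm_num
  rw [hsq, mul_one, hJ, hvS] at hmul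
  rcases jacobiSym.trichotomy (q : ℤ) (genusModulus S) with h | h | h <;> rw [h] at hmul <;> norm_num at hmul

/-! ### The count: every real character is a genus character -/

/-- The index set `P₀`: the odd prime divisors of `d_K`, with the least one removed when `d_K` is
odd. [folklore] -/
theorem mem_P₀ {p : ℕ}
    (hp : p ∈ (((NumberField.discr K).natAbs.primeFactors.erase 2).erase
      (NumberField.discr K).natAbs.minFac)) :
    p.Prime ∧ p ≠ 2 ∧ (p : ℤ) ∣ NumberField.discr K := by
  obtain ⟨-, hp⟩ := Finset.mem_erase.mp hp
  obtain ⟨hp2, hp⟩ := Finset.mem_erase.mp hp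
  obtain ⟨hpp, hpd, -⟩ := Nat.mem_primeFactors.mp hp
  exact ⟨hpp, hp2, Int.natCast_dvd.mpr hpd⟩

/-- `|P₀| = t − 1`, `t = ω(|d_K|)`. [folklore] -/
theorem card_P₀ (h2 : finrank ℚ K = 2) :
    (((NumberField.discr K).natAbs.primeFactors.erase 2).erase (NumberField.discr K).natAbs.minFac).card =
      (NumberField.discr K).natAbs.primeFactors.card - 1 := by
  set D := (NumberField.discr K).natAbs with hD
  have hD1 : D ≠ 1 := by
    have := NumberField.abs_discr_gt_two (K := K) (by rw [h2]; exact one_lt_two)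
    intro h
    have h' : (|NumberField.discr K| : ℤ) = 1 := by rw [Int.abs_eq_natAbs, ← hD, h, Nat.cast_one]
    linarith
  have hD0 : D ≠ 0 := Int.natAbs_ne_zero.mpr (NumberField.discr_ne_zero K)
  by_cases h2D : 2 ∣ D
  · have hmin : D.minFac = 2 := (Nat.minFac_eq_two_iff D).mpr h2D
    have hmem : 2 ∈ D.primeFactors := Nat.mem_primeFactors.mpr ⟨Nat.prime_two, h2D, hD0⟩
    rw [hmin, Finset.erase_eq_of_notMem (Finset.notMem_erase 2 _), Finset.card_erase_of_mem hmem]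
  · have hnot : 2 ∉ D.primeFactors := fun h ↦ h2D (Nat.dvd_of_mem_primeFactors h)
    have hmem : D.minFac ∈ D.primeFactors :=
      Nat.mem_primeFactors.mpr ⟨Nat.minFac_prime hD1, Nat.minFac_dvd D, hD0⟩
    rw [Finset.erase_eq_of_notMem hnot, Finset.card_erase_of_mem hmem]

/-- For `S ⊆ P₀`: `D_S < |d_K|` (a proper divisor: it misses the prime `2` if `d_K` is even, the
least prime divisor if `d_K` is odd). [folklore] -/
theorem genusModulus_lt_of_subset_P₀ (h2 : finrank ℚ K = 2) {S : Finset ℕ}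
    (hS : S ⊆ ((NumberField.discr K).natAbs.primeFactors.erase 2).erase (NumberField.discr K).natAbs.minFac) :
    genusModulus S < (NumberField.discr K).natAbs := by
  set D := (NumberField.discr K).natAbs with hD
  have hS' : ∀ p ∈ S, p.Prime ∧ p ≠ 2 ∧ (p : ℤ) ∣ NumberField.discr K := fun p hp ↦ mem_P₀ (hS hp)
  have hD0 : 0 < D := Int.natAbs_pos.mpr (NumberField.discr_ne_zero K)
  have hD1 : D ≠ 1 := by
    have := NumberField.abs_discr_gt_two (K := K) (by rw [h2]; exact one_lt_two)
    intro h
    have h' : (|NumberField.discr K| : ℤ) = 1 := by rw [Int.abs_eq_natAbs, ← hD, h, Nat.cast_one]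
    linarith
  have hdvd : genusModulus S ∣ D := genusModulus_dvd_natAbs_discr hS'
  refine lt_of_le_of_ne (Nat.le_of_dvd hD0 hdvd) fun heq ↦ ?_
  by_cases h2D : 2 ∣ D
  · -- `D_S` is odd
    have hodd := odd_genusModulus (S := S) fun p hp ↦ ⟨(hS' p hp).1, (hS' p hp).2.1⟩
    rw [heq] at hodd
    exact (Nat.not_even_iff_odd.mpr hodd) (even_iff_two_dvd.mpr h2D)
  · -- the least prime divisor of `D` does not divide `D_S`
    have hminp : D.minFac.Prime := Nat.minFac_prime hD1
    have hmin : D.minFac ∣ genusModulus S := by rw [heq]; exact Nat.minFac_dvd D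
    rw [genusModulus, (Nat.prime_iff.mp hminp).dvd_finsetProd_iff] at hmin
    obtain ⟨p, hp, hdiv⟩ := hmin
    have hpeq : D.minFac = p := (Nat.prime_dvd_prime_iff_eq hminp (hS' p hp).1).mp hdiv
    have := (Finset.mem_erase.mp (hS hp)).1
    exact this hpeq.symm

/-- **Every real character of `Cl_K` is a genus character** (`K` imaginary quadratic): for `χ`
with `χ² = 1` there is `S ⊆ P₀` with `χ = ψ_S`.  The `2^{t−1}` characters `ψ_S`, `S ⊆ P₀`, are
distinct (`eq_of_genusCharProd_eq`) and real, and the real characters number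
`|{χ : χ² = 1}| = |Cl_K[2]| = 2^{t−1}` (`card_monoidHom_mul_self_eq_one`, `card_sq_eq_one_classGroup`):
Gauss, the number of genera is the number of ambiguous classes. [cite: Cox2013, §3.B Thm. 3.15] -/
theorem exists_genusCharProd_eq (hK : IsImaginaryQuadratic K) (χ : ClassGroup (𝓞 K) →* ℂˣ)
    (hχ : χ * χ = 1) :
    ∃ (S : Finset ℕ) (hS : S ⊆ ((NumberField.discr K).natAbs.primeFactors.erase 2).erase
        (NumberField.discr K).natAbs.minFac),
      genusCharProd hK S (fun _ hp ↦ mem_P₀ (hS hp)) = χ := by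
  classical
  set P₀ := ((NumberField.discr K).natAbs.primeFactors.erase 2).erase (NumberField.discr K).natAbs.minFac
    with hP₀
  set t := (NumberField.discr K).natAbs.primeFactors.card with ht
  -- the map `S ↦ ψ_S` on subsets of `P₀`, into the real characters
  let Φ : {S : Finset ℕ // S ∈ P₀.powerset} → {χ : ClassGroup (𝓞 K) →* ℂˣ // χ * χ = 1} :=
    fun S ↦ ⟨genusCharProd hK S.1 (fun _ hp ↦ mem_P₀ (Finset.mem_powerset.mp S.2 hp)), genusCharProd_mul_self⟩
  have hinj : Function.Injective Φ := by
    rintro ⟨S, hS⟩ ⟨T, hT⟩ h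
    have hS' := Finset.mem_powerset.mp hS
    have hT' := Finset.mem_powerset.mp hT
    have heq := congrArg Subtype.val h
    simp only [Φ] at heq
    have hsub : symmDiff S T ⊆ P₀ := fun p hp ↦ by
      rcases Finset.mem_symmDiff.mp hp with ⟨h, -⟩ | ⟨h, -⟩
      · exact hS' h
      · exact hT' h
    exact Subtype.ext (eq_of_genusCharProd_eq hK _ _ heq (genusModulus_lt_of_subset_P₀ hK.1 hsub))
  -- cardinalities
  have hcardR : Nat.card {χ : ClassGroup (𝓞 K) →* ℂˣ // χ * χ = 1} = 2 ^ (t - 1) := by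
    rw [Literature.NumberTheory.NumberFields.card_monoidHom_mul_self_eq_one, card_sq_eq_one_classGroup hK]
  have hcardP : Nat.card {S : Finset ℕ // S ∈ P₀.powerset} = 2 ^ (t - 1) := by
    rw [Nat.card_eq_finsetCard P₀.powerset, Finset.card_powerset, card_P₀ hK.1]
  haveI : Finite {χ : ClassGroup (𝓞 K) →* ℂˣ // χ * χ = 1} :=
    Nat.finite_of_card_ne_zero (by rw [hcardR]; positivity)
  have hbij : Function.Bijective Φ :=
    (Nat.bijective_iff_injective_and_card Φ).mpr ⟨hinj, by rw [hcardP, hcardR]⟩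
  obtain ⟨⟨S, hS⟩, hSχ⟩ := hbij.2 ⟨χ, hχ⟩
  exact ⟨S, Finset.mem_powerset.mp hS, congrArg Subtype.val hSχ⟩

/-! ### Siegel's bound for all real class group characters -/

/-- **Lower bound for `1 − β` at real zeros of `L(s, χ)`, `χ ≠ 1` a real class group character,
uniformly over imaginary quadratic fields**: for every `ε > 0` there is `C(ε) > 0` such that for
every imaginary quadratic field `K`, every `χ : Cl_K →* ℂˣ` with `χ² = 1`, `χ ≠ 1`, and every real
`β` with `L₀(β, χ) = 0`: `C |d_K|^{−ε} ≤ 1 − β` (every such `χ` is a genus character `ψ_S`,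
`exists_genusCharProd_eq`, and `exists_one_sub_realZero_genusCharProd_ge`).  With the Dedekind zeta
case (`exists_one_sub_realZero_dedekindZetaCont_ge`) this is Thorner–Zaman's Theorem 3.3 for the
real characters of `H_K/K`. [cite: ThornerZaman2019, Thm. 3.3] -/
theorem exists_one_sub_realZero_classGroupLFunction₀_ge {ε : ℝ} (hε : 0 < ε) :
    ∃ C : ℝ, 0 < C ∧ ∀ (K : Type) [Field K] [NumberField K], IsImaginaryQuadratic K →
      ∀ (χ : ClassGroup (𝓞 K) →* ℂˣ), χ * χ = 1 → χ ≠ 1 → ∀ β : ℝ,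
        classGroupLFunction₀ K χ β = 0 → C * (|(NumberField.discr K : ℝ)|) ^ (-ε) ≤ 1 - β := by
  obtain ⟨C, hC, h⟩ := exists_one_sub_realZero_genusCharProd_ge hε
  refine ⟨C, hC, fun K _ _ hK χ hχ2 hχ β hβ ↦ ?_⟩
  obtain ⟨S, hS, hSχ⟩ := exists_genusCharProd_eq hK χ hχ2
  subst hSχ
  exact h K hK S _ hχ β hβ

end Literature.NumberTheory.QuadraticFields.Quadratic

end
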